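import Literature.IUT.HodgeTheaters.GlobalFrobenioidsFcircBaseOnEquivalences
import Literature.AlgebraicGeometry.Frobenioids.ModelFrobenioidRestrictionFiberProduct
import HarnessLib

/-!
# [IUTchI] Example 5.1 (iii) / Corollary 5.3 (i), the `⊚`-conjunct AT THE ISOMORPHS: for ANY `†ℱ^⊛` "equivalent to
# `ℱ^⊛(†𝒟^⊚)`" (abc-iut-L5-t1's `GlobalFrobenioid` records over the genuine arithmetic data) the restriction
# `†ℱ^⊚ := †ℱ^⊛|_{†𝒟^⊚} = CFP F.toBase F.baseMor` has a `1`-unique `Ψ^Base : ¹𝒟^⊚ ⥲ ²𝒟^⊚` under every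
# `Ψ : ¹ℱ^⊚ ⥲ ²ℱ^⊚`, hence `HasUnder` / `UnderUnique` for the base functors `ⁱℱ^⊚ → ⁱ𝒟^⊚`

S. Mochizuki, *Inter-universal Teichmüller theory I*, kurims manuscript (May 2020), Example 5.1 (iii) pp. 125–126 and
Corollary 5.3 (i) p. 144 l. 1–13 ("the natural map `Isom(¹ℱ^⊚, ²ℱ^⊚) → Isom(Base(¹ℱ^⊚), Base(²ℱ^⊚))` is bijective")
([IUTchI] Cor 5.3 (i) p.144) [claim: Mochizuki2012, status: disputed] — nothing of the series is asserted; no side is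
taken on [IUTchIII] Cor. 3.12.  The mathematics is [FrdI] §0 p. 17 (categorical fibre products), Prop. 1.6 p. 27 and
Cor. 4.11 (ii) pp. 91–92 [cite: MochizukiFrdI2008, Cor. 4.11 p.91].

PROOF-ONLY file (cell abc-iut; seat abc-iut-w4-d109; row «C53i ⊚-TWIN», step 3/3 = record level, the exact `⊚` analogue
of abc-iut-L6-t7's `GlobalFrobenioid.hasUnder_toBase` / `underUnique_toBase`), 0 definitions.
* §1 (any divisor data `Δ`): the restriction `†ℱ^⊚ = CFP F.toBase F.baseMor` of a record `F : GlobalFrobenioid Δ Dᶜ toBase0`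
  is EQUIVALENT, OVER `Dᶜ` ON THE NOSE (`Q ⋙ pr₂ = F.fcircBase`), to the fibre product of the MODEL
  `ℱ^⊛(†𝒟^⊚) ×_{ℬ(G)⁰} Dᶜ` along `F.baseMor ⋙ F.identify` — chain of abc-iut-f-027's [FrdI] §0 invariances
  (`ModelFrobenioidRestrictionFiberProduct.lean`, consumed BY NAME): post-compose both legs with the equivalence
  `identify`, replace the first leg along `toBase_compat : toBase ⋙ identify ≅ equiv ⋙ Base`, pre-compose the first
  corner with `equiv`;
* §2 (`Δᵢ = arithAlong Fᵢ ρᵢ hρᵢ`): for two records and every `Ψ : ¹ℱ^⊚ ⥲ ²ℱ^⊚` a `1`-unique `Ψ^Base : D₁ᶜ ⥲ D₂ᶜ` with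
  `Ψ ⋙ ²fcircBase ≅ ¹fcircBase ⋙ Ψ^Base` (abc-iut-w4-d109's model-level `⊚`-twin
  `GlobalDivisorData.exists_oneUniqueSquare_proj₂_fiberProduct_arithAlong` transported along `Qᵢ` by abc-iut-L6-t7's
  `OneUniqueSquare.of_equiv_top` / `of_iso_sides`); hence `CatIsomorphism.HasUnder` / `UnderUnique` for the base functors
  `ⁱℱ^⊚ → Dᵢᶜ`; binders = {`Dᵢᶜ` connected · totally epimorphic · FSM-type · slim} — THEOREMS at `Dᵢᶜ = ℬ(Hᵢ)⁰` for slim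
  `Hᵢ` (no hypothesis on `Gᵢ`);
* §3: the same over `ℬ(G_F)⁰` (`arith F`).

HONEST LIMITS.  Existence + essential uniqueness of the base equivalence (the `⊚` natural map of Cor. 5.3 (i) EXISTS for
every pair of isomorphs); bijectivity = Ex. 5.1 (v)'s model case (FACT-policy), not claimed.  Nothing here bears on
[IUTchIII] Cor. 3.12; typed ≠ proved elsewhere.
-/

noncomputable section

-- `ModelFrobenioid.baseFunctor` / `PreFrobenioid.baseFunctor (toElem …)` / `arithAlong` fields agree only at default
-- transparency.
set_option backward.isDefEq.respectTransparency false

namespace Literature.IUT.HodgeTheaters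

open CategoryTheory Opposite
open Literature.AlgebraicGeometry.Frobenioids Literature.AnabelianGeometry.SemiGraphs
open Literature.AlgebraicGeometry.Frobenioids.QuasiTemperoid

universe v u

namespace GlobalFrobenioid

/-! ### §1. `†ℱ^⊚` of an isomorph IS (over `†𝒟^⊚`, on the nose) the fibre product of the model -/

section AnyData

variable {G : ProfiniteGrp.{u}} {Δ : GlobalDivisorData G} {Dcirc : Type (u + 1)} [Category.{u} Dcirc]
  {toBase0 : Dcirc ⥤ BaseCat G} (F : GlobalFrobenioid Δ Dcirc toBase0)

/-- **`†ℱ^⊚ := †ℱ^⊛|_{†𝒟^⊚}` of ANY isomorph `†ℱ^⊛` is equivalent, OVER `†𝒟^⊚` ON THE NOSE, to the fibre product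
`ℱ^⊛(†𝒟^⊚) ×_{ℬ(G)⁰} †𝒟^⊚` of the MODEL along `baseMor ⋙ identify`** ([IUTchI] Ex. 5.1 (iii): "any category
equivalent to `ℱ^⊛(†𝒟^⊚)`", "`†𝒟^⊚ → Base(†ℱ^⊛)` abstractly equivalent to `†𝒟^⊚ → †𝒟^⊛`", "the restriction of `†ℱ^⊛`
to `†𝒟^⊚`") — [FrdI] §0: post-compose both legs with `identify`, swap the first leg along `toBase_compat`, pre-compose
with `equiv`. ([IUTchI] Ex 5.1 (iii) p.125) [claim: Mochizuki2012, status: disputed] -/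
theorem exists_fcirc_equivalence_fiberProduct_over :
    ∃ Q : F.Fcirc ≌ CFP Δ.modelBase (F.baseMor ⋙ F.identify.functor),
      Q.functor ⋙ CFP.proj₂ Δ.modelBase (F.baseMor ⋙ F.identify.functor) = F.fcircBase := by
  obtain ⟨E₁, -, h₁⟩ := CFP.exists_equivalence_postcomp F.toBase F.baseMor F.identify.functor
  obtain ⟨E₂, -, h₂⟩ := CFP.exists_equivalence_of_iso_left F.toBase_compat (F.baseMor ⋙ F.identify.functor)
  obtain ⟨E₃, -, h₃⟩ := CFP.exists_equivalence_precomp F.equiv Δ.modelBase (F.baseMor ⋙ F.identify.functor)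
  refine ⟨E₁.trans (E₂.trans E₃), ?_⟩
  show (E₁.functor ⋙ E₂.functor ⋙ E₃.functor) ⋙ CFP.proj₂ Δ.modelBase (F.baseMor ⋙ F.identify.functor) =
    F.fcircBase
  rw [Functor.assoc, Functor.assoc, h₃, h₂, h₁]

end AnyData

/-! ### §2. The `⊚`-twin for isomorphs over `†𝒟^⊛ = ℬ(G)⁰` (`Δ = arithAlong F ρ hρ`) -/

section Along

variable {G₁ : ProfiniteGrp.{0}} {F₁ : Type} [Field F₁] [NumberField F₁] {ρ₁ : G₁ →ₜ* GalFbar F₁}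
  {hρ₁ : Function.Surjective ρ₁} {D₁ : Type 1} [Category.{0} D₁] {toBase0₁ : D₁ ⥤ BaseCat G₁}
variable {G₂ : ProfiniteGrp.{0}} {F₂ : Type} [Field F₂] [NumberField F₂] {ρ₂ : G₂ →ₜ* GalFbar F₂}
  {hρ₂ : Function.Surjective ρ₂} {D₂ : Type 1} [Category.{0} D₂] {toBase0₂ : D₂ ⥤ BaseCat G₂}
variable (𝓕₁ : GlobalFrobenioid (GlobalDivisorData.arithAlong F₁ ρ₁ hρ₁) D₁ toBase0₁)
  (𝓕₂ : GlobalFrobenioid (GlobalDivisorData.arithAlong F₂ ρ₂ hρ₂) D₂ toBase0₂)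

/-- **[FrdI] Cor. 4.11 (ii) at the restrictions `ⁱℱ^⊚ = ⁱℱ^⊛|_{ⁱ𝒟^⊚}` of ANY two isomorphs of the genuine arithmetic
models**: for every equivalence `Ψ : ¹ℱ^⊚ ⥲ ²ℱ^⊚` there is a `1`-UNIQUE `Ψ^Base : D₁ᶜ ⥲ D₂ᶜ` with
`Ψ ⋙ ²(ℱ^⊚ → 𝒟^⊚) ≅ ¹(ℱ^⊚ → 𝒟^⊚) ⋙ Ψ^Base`, as soon as `Dᵢᶜ` is connected, totally epimorphic, of FSM-type and slim.
([IUTchI] Cor 5.3 (i) p.144) [claim: Mochizuki2012, status: disputed] -/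
theorem exists_oneUniqueSquare_fcircBase_arithAlong (hc₁ : IsGraphConnected D₁) (he₁ : IsTotallyEpimorphic D₁)
    (hfsm₁ : IsOfFSMType D₁) (hsl₁ : IsSlim D₁) (hc₂ : IsGraphConnected D₂) (he₂ : IsTotallyEpimorphic D₂)
    (hfsm₂ : IsOfFSMType D₂) (hsl₂ : IsSlim D₂) (Ψ : 𝓕₁.Fcirc ≌ 𝓕₂.Fcirc) :
    ∃ ΨBase : D₁ ⥤ D₂, PreFrobenioidData.OneUniqueSquare Ψ.functor 𝓕₁.fcircBase 𝓕₂.fcircBase ΨBase := by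
  obtain ⟨Q₁, hQ₁⟩ := 𝓕₁.exists_fcirc_equivalence_fiberProduct_over
  obtain ⟨Q₂, hQ₂⟩ := 𝓕₂.exists_fcirc_equivalence_fiberProduct_over
  obtain ⟨B₀, hB₀⟩ := GlobalDivisorData.exists_oneUniqueSquare_proj₂_fiberProduct_arithAlong F₁ ρ₁ hρ₁
    (𝓕₁.baseMor ⋙ 𝓕₁.identify.functor) F₂ ρ₂ hρ₂ (𝓕₂.baseMor ⋙ 𝓕₂.identify.functor) hc₁ he₁ hfsm₁ hsl₁ hc₂ he₂
    hfsm₂ hsl₂ (Q₁.symm.trans (Ψ.trans Q₂))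
  have hB₀' : PreFrobenioidData.OneUniqueSquare (Q₁.inverse ⋙ Ψ.functor ⋙ Q₂.functor)
      (CFP.proj₂ (GlobalDivisorData.arithAlong F₁ ρ₁ hρ₁).modelBase (𝓕₁.baseMor ⋙ 𝓕₁.identify.functor))
      (CFP.proj₂ (GlobalDivisorData.arithAlong F₂ ρ₂ hρ₂).modelBase (𝓕₂.baseMor ⋙ 𝓕₂.identify.functor)) B₀ := hB₀
  have h1 := hB₀'.of_equiv_top Q₁ Q₂ (T' := Ψ.functor) (Q₁.funInvIdAssoc (Ψ.functor ⋙ Q₂.functor))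
  exact ⟨B₀, h1.of_iso_sides (eqToIso hQ₁) (eqToIso hQ₂)⟩

/-- **`HasUnder` for the base functors `ⁱℱ^⊚ → ⁱ𝒟^⊚` of the restrictions of two isomorphs** (abc-iut-L6-t7's bridge),
binders on `Dᵢᶜ` only. ([IUTchI] Cor 5.3 (i) p.144) [claim: Mochizuki2012, status: disputed] -/
theorem hasUnder_fcircBase_arithAlong (hc₁ : IsGraphConnected D₁) (he₁ : IsTotallyEpimorphic D₁)
    (hfsm₁ : IsOfFSMType D₁) (hsl₁ : IsSlim D₁) (hc₂ : IsGraphConnected D₂) (he₂ : IsTotallyEpimorphic D₂)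
    (hfsm₂ : IsOfFSMType D₂) (hsl₂ : IsSlim D₂) :
    CatIsomorphism.HasUnder 𝓕₁.fcircBase 𝓕₂.fcircBase :=
  CatIsomorphism.hasUnder_of_forall_oneUniqueSquare fun Ψ =>
    exists_oneUniqueSquare_fcircBase_arithAlong 𝓕₁ 𝓕₂ hc₁ he₁ hfsm₁ hsl₁ hc₂ he₂ hfsm₂ hsl₂ Ψ

/-- **`UnderUnique` for the base functors `ⁱℱ^⊚ → ⁱ𝒟^⊚` of the restrictions of two isomorphs**, binders on `Dᵢᶜ`
only — so `CatIsomorphism.descend : Isom(¹ℱ^⊚, ²ℱ^⊚) → Isom(¹𝒟^⊚, ²𝒟^⊚)` (the `⊚` natural map of Cor. 5.3 (i)) is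
DEFINED here without further binders. ([IUTchI] Cor 5.3 (i) p.144) [claim: Mochizuki2012, status: disputed] -/
theorem underUnique_fcircBase_arithAlong (hc₁ : IsGraphConnected D₁) (he₁ : IsTotallyEpimorphic D₁)
    (hfsm₁ : IsOfFSMType D₁) (hsl₁ : IsSlim D₁) (hc₂ : IsGraphConnected D₂) (he₂ : IsTotallyEpimorphic D₂)
    (hfsm₂ : IsOfFSMType D₂) (hsl₂ : IsSlim D₂) :
    CatIsomorphism.UnderUnique 𝓕₁.fcircBase 𝓕₂.fcircBase :=
  CatIsomorphism.underUnique_of_forall_oneUniqueSquare fun Ψ =>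
    exists_oneUniqueSquare_fcircBase_arithAlong 𝓕₁ 𝓕₂ hc₁ he₁ hfsm₁ hsl₁ hc₂ he₂ hfsm₂ hsl₂ Ψ

end Along

section AlongBaseCat

variable {G₁ H₁ : ProfiniteGrp.{0}} {F₁ : Type} [Field F₁] [NumberField F₁] {ρ₁ : G₁ →ₜ* GalFbar F₁}
  {hρ₁ : Function.Surjective ρ₁} {toBase0₁ : BaseCat H₁ ⥤ BaseCat G₁}
variable {G₂ H₂ : ProfiniteGrp.{0}} {F₂ : Type} [Field F₂] [NumberField F₂] {ρ₂ : G₂ →ₜ* GalFbar F₂}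
  {hρ₂ : Function.Surjective ρ₂} {toBase0₂ : BaseCat H₂ ⥤ BaseCat G₂}
variable (𝓕₁ : GlobalFrobenioid (GlobalDivisorData.arithAlong F₁ ρ₁ hρ₁) (BaseCat H₁) toBase0₁)
  (𝓕₂ : GlobalFrobenioid (GlobalDivisorData.arithAlong F₂ ρ₂ hρ₂) (BaseCat H₂) toBase0₂)

/-- **The record-level `⊚`-twin at `ⁱ𝒟^⊚ = ℬ(Hᵢ)⁰`, `ⁱ𝒟^⊛ = ℬ(Gᵢ)⁰`** (print: `ℬ(π₁(†𝒟^⊚))⁰ → ℬ(π₁(†𝒟^⊛))⁰`):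
`HasUnder ∧ UnderUnique` for the base functors `ⁱℱ^⊚ → ℬ(Hᵢ)⁰` of ANY two isomorphs, MODULO ONLY `IsSlimGroup Hᵢ`.
([IUTchI] Cor 5.3 (i) p.144) [claim: Mochizuki2012, status: disputed] -/
theorem hasUnder_and_underUnique_fcircBase_arithAlong_baseCat (hZ₁ : IsSlimGroup H₁) (hZ₂ : IsSlimGroup H₂) :
    CatIsomorphism.HasUnder 𝓕₁.fcircBase 𝓕₂.fcircBase ∧ CatIsomorphism.UnderUnique 𝓕₁.fcircBase 𝓕₂.fcircBase :=
  ⟨hasUnder_fcircBase_arithAlong 𝓕₁ 𝓕₂ (isGraphConnected_baseCat H₁) (isTotallyEpimorphic_baseCat H₁)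
      (isOfFSMType_baseCat H₁) (isSlim_baseCat_of_isSlimGroup H₁ hZ₁) (isGraphConnected_baseCat H₂)
      (isTotallyEpimorphic_baseCat H₂) (isOfFSMType_baseCat H₂) (isSlim_baseCat_of_isSlimGroup H₂ hZ₂),
    underUnique_fcircBase_arithAlong 𝓕₁ 𝓕₂ (isGraphConnected_baseCat H₁) (isTotallyEpimorphic_baseCat H₁)
      (isOfFSMType_baseCat H₁) (isSlim_baseCat_of_isSlimGroup H₁ hZ₁) (isGraphConnected_baseCat H₂)
      (isTotallyEpimorphic_baseCat H₂) (isOfFSMType_baseCat H₂) (isSlim_baseCat_of_isSlimGroup H₂ hZ₂)⟩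

end AlongBaseCat

/-! ### §3. The `⊚`-twin for isomorphs over `†𝒟^⊛ = ℬ(G_F)⁰` (`Δ = arith F`) -/

section Arith

variable {F₁ : Type} [Field F₁] [NumberField F₁] {D₁ : Type 1} [Category.{0} D₁]
  {toBase0₁ : D₁ ⥤ BaseCat (absGalGrp F₁)}
variable {F₂ : Type} [Field F₂] [NumberField F₂] {D₂ : Type 1} [Category.{0} D₂]
  {toBase0₂ : D₂ ⥤ BaseCat (absGalGrp F₂)}
variable (𝓕₁ : GlobalFrobenioid (GlobalDivisorData.arith F₁) D₁ toBase0₁)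
  (𝓕₂ : GlobalFrobenioid (GlobalDivisorData.arith F₂) D₂ toBase0₂)

/-- **The record-level `⊚`-twin over `ℬ(G_F)⁰`**: a `1`-unique `Ψ^Base : D₁ᶜ ⥲ D₂ᶜ` over the base functors
`ⁱℱ^⊚ → ⁱ𝒟^⊚` under every `Ψ : ¹ℱ^⊚ ⥲ ²ℱ^⊚`, for `Dᵢᶜ` connected, totally epimorphic, FSM-type, slim.
([IUTchI] Cor 5.3 (i) p.144) [claim: Mochizuki2012, status: disputed] -/
theorem exists_oneUniqueSquare_fcircBase_arith (hc₁ : IsGraphConnected D₁) (he₁ : IsTotallyEpimorphic D₁)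
    (hfsm₁ : IsOfFSMType D₁) (hsl₁ : IsSlim D₁) (hc₂ : IsGraphConnected D₂) (he₂ : IsTotallyEpimorphic D₂)
    (hfsm₂ : IsOfFSMType D₂) (hsl₂ : IsSlim D₂) (Ψ : 𝓕₁.Fcirc ≌ 𝓕₂.Fcirc) :
    ∃ ΨBase : D₁ ⥤ D₂, PreFrobenioidData.OneUniqueSquare Ψ.functor 𝓕₁.fcircBase 𝓕₂.fcircBase ΨBase := by
  obtain ⟨Q₁, hQ₁⟩ := 𝓕₁.exists_fcirc_equivalence_fiberProduct_over
  obtain ⟨Q₂, hQ₂⟩ := 𝓕₂.exists_fcirc_equivalence_fiberProduct_over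
  obtain ⟨B₀, hB₀⟩ := GlobalDivisorData.exists_oneUniqueSquare_proj₂_fiberProduct_arith F₁
    (𝓕₁.baseMor ⋙ 𝓕₁.identify.functor) F₂ (𝓕₂.baseMor ⋙ 𝓕₂.identify.functor) hc₁ he₁ hfsm₁ hsl₁ hc₂ he₂ hfsm₂ hsl₂
    (Q₁.symm.trans (Ψ.trans Q₂))
  have hB₀' : PreFrobenioidData.OneUniqueSquare (Q₁.inverse ⋙ Ψ.functor ⋙ Q₂.functor)
      (CFP.proj₂ (GlobalDivisorData.arith F₁).modelBase (𝓕₁.baseMor ⋙ 𝓕₁.identify.functor))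
      (CFP.proj₂ (GlobalDivisorData.arith F₂).modelBase (𝓕₂.baseMor ⋙ 𝓕₂.identify.functor)) B₀ := hB₀
  have h1 := hB₀'.of_equiv_top Q₁ Q₂ (T' := Ψ.functor) (Q₁.funInvIdAssoc (Ψ.functor ⋙ Q₂.functor))
  exact ⟨B₀, h1.of_iso_sides (eqToIso hQ₁) (eqToIso hQ₂)⟩

/-- **`HasUnder ∧ UnderUnique` for the base functors `ⁱℱ^⊚ → ⁱ𝒟^⊚` over `ℬ(G_F)⁰`**, binders on `Dᵢᶜ` only.
([IUTchI] Cor 5.3 (i) p.144) [claim: Mochizuki2012, status: disputed] -/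
theorem hasUnder_and_underUnique_fcircBase_arith (hc₁ : IsGraphConnected D₁) (he₁ : IsTotallyEpimorphic D₁)
    (hfsm₁ : IsOfFSMType D₁) (hsl₁ : IsSlim D₁) (hc₂ : IsGraphConnected D₂) (he₂ : IsTotallyEpimorphic D₂)
    (hfsm₂ : IsOfFSMType D₂) (hsl₂ : IsSlim D₂) :
    CatIsomorphism.HasUnder 𝓕₁.fcircBase 𝓕₂.fcircBase ∧ CatIsomorphism.UnderUnique 𝓕₁.fcircBase 𝓕₂.fcircBase :=
  ⟨CatIsomorphism.hasUnder_of_forall_oneUniqueSquare fun Ψ =>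
      exists_oneUniqueSquare_fcircBase_arith 𝓕₁ 𝓕₂ hc₁ he₁ hfsm₁ hsl₁ hc₂ he₂ hfsm₂ hsl₂ Ψ,
    CatIsomorphism.underUnique_of_forall_oneUniqueSquare fun Ψ =>
      exists_oneUniqueSquare_fcircBase_arith 𝓕₁ 𝓕₂ hc₁ he₁ hfsm₁ hsl₁ hc₂ he₂ hfsm₂ hsl₂ Ψ⟩

/-- **… MODULO ONLY `IsSlimGroup Hᵢ` at `ⁱ𝒟^⊚ = ℬ(Hᵢ)⁰`.** ([IUTchI] Cor 5.3 (i) p.144) [claim: Mochizuki2012, status: disputed] -/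
theorem hasUnder_and_underUnique_fcircBase_arith_baseCat {H₁ H₂ : ProfiniteGrp.{0}}
    {toBase0₁ : BaseCat H₁ ⥤ BaseCat (absGalGrp F₁)} {toBase0₂ : BaseCat H₂ ⥤ BaseCat (absGalGrp F₂)}
    (𝓕₁ : GlobalFrobenioid (GlobalDivisorData.arith F₁) (BaseCat H₁) toBase0₁)
    (𝓕₂ : GlobalFrobenioid (GlobalDivisorData.arith F₂) (BaseCat H₂) toBase0₂) (hZ₁ : IsSlimGroup H₁)
    (hZ₂ : IsSlimGroup H₂) :
    CatIsomorphism.HasUnder 𝓕₁.fcircBase 𝓕₂.fcircBase ∧ CatIsomorphism.UnderUnique 𝓕₁.fcircBase 𝓕₂.fcircBase :=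
  hasUnder_and_underUnique_fcircBase_arith 𝓕₁ 𝓕₂ (isGraphConnected_baseCat H₁) (isTotallyEpimorphic_baseCat H₁)
    (isOfFSMType_baseCat H₁) (isSlim_baseCat_of_isSlimGroup H₁ hZ₁) (isGraphConnected_baseCat H₂)
    (isTotallyEpimorphic_baseCat H₂) (isOfFSMType_baseCat H₂) (isSlim_baseCat_of_isSlimGroup H₂ hZ₂)

end Arith

end GlobalFrobenioid

end Literature.IUT.HodgeTheaters

end
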